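import Mathlib
import HarnessLib
import Summits.HubbardSuperconductivity.HubbardSuperconductivity.Theorems.KLProgrammeKLRegimeEngineTowerLevReadoutCloseFLinkKlEngSharpUnifRows
import Summits.HubbardSuperconductivity.HubbardSuperconductivity.Theorems.KLProgrammeKLRegimeEngineTowerLevReadoutUVF
import Summits.HubbardSuperconductivity.HubbardSuperconductivity.Theorems.KLProgrammeKLRegimeEngineTowerBlockZeroPackageKlEng

/-!
# Route `KLProgramme` — crux K3 ENGINE (stmt-HubbardSuperconductivity-20437 `KLRegimeEngineV17F2`), stub (b) v2, THE LEVELS PACKAGE (ℓ): «(ℓ)-REKEY-ROWS»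
# LINK 6, GUARDED DOMINATION (cell gate-hubbard-kl, seat p4 g22 on p3 g22's `kernelNormsLevels_all_klEng_final_rows_closed`, p699409)

WHY.  p3 g22's closed assembly (…TowerLevAssemblyKlEngFinalRowsClosed) asks the DOMINATION of block `0`'s base read-out constants by the main tower's
amplitudes — `Atot₁ ≤ Ab'`, `Qtot₁ ≤ Qb` — UNCONDITIONALLY, although its proof reads them only in the branch `d ≤ j (≤ n)`.  `Atot₁` is evaluated at the
coupling `λ_d = B·ε_d`, which the KL-regime arithmetic bounds (`λ_d ≤ uf`) only when `d ≤ n`; for the early levels `n < d` (every `j ≤ n` then lies in block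
`0`) the unguarded row is not a consequence of the doors, so the numerics side could not discharge it («(ℓ)-CLOSED-DOMINATION-GUARD», located by p4 g22).
This file is p699409 VERBATIM with the two domination binders GUARDED — `(d ≤ n → Atot₁ ≤ Ab') → (d ≤ n → Qtot₁ ≤ Qb) →` — and the proof reading them as
`hAtle hdn` / `hQtle hdn` in the branch `d ≤ j` (where `hdn : d ≤ n` is in scope); nothing else changes (statement, binder order, proof).

* **`kernelNormsLevels_all_klEng_final_rows_closedG (c″)`** ⊢ `∀ j ≤ n, KernelNormsLevels L M P Qe β U μ (klFlowFrameU L M β U μ n) j`.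
Bookkeeping composition of landed theorems (p3 g22's text); every analytic and numerical input is a hypothesis; nothing asserts (ℓ), any stub, K3 or
superconductivity.
References: BGM 2006 §2.8 (2.76)–(2.84), (2.93)–(2.98), Lemma 2.5, §3 (3.2)–(3.8) [cite: BenfattoGiulianiMastropietro2006].
-/

noncomputable section

namespace Summit.HubbardSuperconductivity.HubbardSuperconductivity.Theorems.EngineV8

set_option linter.dupNamespace false -- summit = problem name (single-conjunct summit), D-0017

open Classical
open Real Finset Literature.MathematicalPhysics.QuantumLattice Literature.Probability.LatticeModels GrassmannAlgebra
open Literature.Probability.LatticeModels.BattleFederbush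
open Literature.MathematicalPhysics.QuantumLattice.FermiRG
open Summit.HubbardSuperconductivity.HubbardSuperconductivity.Theorems.KLProgrammeLegKernels
open Summit.HubbardSuperconductivity.HubbardSuperconductivity.Theorems.KLRegimeSplit
open Summit.HubbardSuperconductivity.HubbardSuperconductivity.Theorems.KLRegimeWick
open Summit.HubbardSuperconductivity.HubbardSuperconductivity.Theorems.TorusFourierL2
open Summit.HubbardSuperconductivity.HubbardSuperconductivity.Theorems.DispersionFlow

variable {L M : ℕ} [NeZero L] [NeZero M]

set_option maxHeartbeats 400000 in -- one ~200-binder composition instantiated per level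
/-- **STUB (b)'s LEVELS CLAUSE ON THE FLOW FRAME — FINAL ASSEMBLY, BASE DATUM AND `Z^{K_n}_{Λ_d}` DISCHARGED FROM BLOCK 0, DOMINATION GUARDED BY `d ≤ n`**
(«(ℓ)-REKEY-ROWS» link 6 = p3 g22's `kernelNormsLevels_all_klEng_final_rows_closed` with the two domination rows under `d ≤ n →`; see the module docstring):
conclusion `∀ j ≤ n, KernelNormsLevels L M P Qe β U μ (klFlowFrameU L M β U μ n) j`. [cite: BenfattoGiulianiMastropietro2006, §2.8 (2.76)-(2.84), (2.93)-(2.98), Lemma 2.5 (2.98), §3 (3.2)-(3.8)] -/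
theorem kernelNormsLevels_all_klEng_final_rows_closedG (c'' : ℝ) (hc'' : 0 < c'') :
    ∃ C₁ C₂ C₁' C₂' Cinc Dinc : ℝ, 0 < C₁ ∧ 0 < C₂ ∧ 0 < C₁' ∧ 0 < C₂' ∧ 0 < Cinc ∧ 1 ≤ Dinc ∧
    ∀ R : RenConsts, R.WF2 → ∃ c₃' : ℝ, 0 < c₃' ∧ ∃ U₀' : ℝ, 0 < U₀' ∧
      ∃ Cκ CJ : ℝ, 0 < Cκ ∧ 0 < CJ ∧ ∀ d : ℕ, ∃ Cb : ℝ, 0 < Cb ∧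
      -- block 0's own constants (p3 g22's `kernelNormsLevels_blockZeroF_klEng d c''`): increment constants, thresholds, link triple — all indexed by `d`
      ∃ Cinc₀ Dinc₀ Cinc₁ Dinc₁ c₃'' U₀'' : ℝ, 0 < Cinc₀ ∧ 1 ≤ Dinc₀ ∧ 1 ≤ Cinc₁ ∧ 1 ≤ Dinc₁ ∧ 0 < c₃'' ∧ 0 < U₀'' ∧
      ∃ Cκ₀ Cb₀ CJ₀ : ℝ, 0 < Cκ₀ ∧ 0 < Cb₀ ∧ 0 < CJ₀ ∧
      ∀ (G : GeoConsts) (P : SplitConsts) (Qh : EngConsts) (c : ℝ), P.WF → 0 < c → c ≤ klEngC₃6 P R → c ≤ c₃' → c ≤ c₃'' →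
      ∀ μ ∈ klWindowC, ∀ U : ℝ, 0 < U → U ≤ klEngU₀9 P R c → U ≤ U₀' → U ≤ U₀'' → c'' * U ≤ 1 → ∀ β : ℝ, klBetaMin ≤ β → β ≤ Real.exp (c / U ^ 2) →
      ∀ (L M : ℕ) [NeZero L] [NeZero M], klEngL₃ β U ≤ L → klEngM₃ β U L ≤ M →
      ∀ n : ℕ, 1 ≤ n → n ≤ nScales β + 1 → IsKLRegime U c (-(n : ℤ)) →
        HistP klPredsV17F2 L M G P Qh R β U μ 0 n → FrameOK R U (nScales β) μ (klFlowFrameU L M β U μ n) →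
        (∀ m, 1 ≤ m → m < n → FlowPieceOscAt L M c'' β U μ m) →
      2 ≤ d → ∀ D : ℕ, 3 ≤ D →
      ∀ (cc : ℝ) (n' : ℕ), IsKLRegime U cc (-(n' : ℤ)) → n ≤ n' →
      ∀ (B : ℝ), 1 ≤ B →
      -- the main tower's base amplitudes `Ab Qb` (must dominate block 0's base read-out constants `Atot₁ d`, `Qtot₁`, see below) and the imports `ι₂ X`;
      -- the base DATUM itself (`𝒱_d[K_n]` at `F_{d−1}`) and `Z^{K_n}_{Λ_d}` are DISCHARGED from block 0 inside (p3 g22 «(ℓ)-BLOCK0-PACKAGE»)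
      ∀ (Ab Qb ι₂ X : ℝ), 0 < Ab → 0 ≤ Qb → 0 ≤ ι₂ → 0 ≤ X →
      ∀ (Ab' ι₂' X' : ℝ), Ab' = Ab / B ^ 2 → ι₂' = ι₂ / B → X' = X / B ^ 2 →
      -- the floor LINK data DISCHARGED on the flow frame (`linkDataPartialF_klEng'`): the four k-free constants pinned, the degree cap kept
      ∀ (κb αb crb ccb : ℝ), κb = Real.sqrt (2 * Cκ * klE0) → αb = Cb * ((M : ℝ) / β) * (4 : ℝ) ^ d / klE0 →
        crb = 81 * CJ * M / β → ccb = 162 * CJ * M / β →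
      (∀ k, 1 ≤ k → d * k ≤ n → Fintype.card (SpaceTimeIdx L M × SectorLeg (sectorCount (d * k - 1))) / 2 ≤ D) →
      -- the law's six names PINNED by the link (equational binders), and the import `ι₁`
      ∀ (W Z σ Φ ψ τ ι₁ : ℝ), W = 64 * (27 : ℝ) ^ 4 * exp 2 * crb / ccb → Z = exp 4 * ccb ^ 2 * imagTimeWeight β M ^ 2 / 8 →
        σ = κb ^ 2 / (exp 4 * ccb ^ 2) → Φ = 9 * αb * ccb / ((27 : ℝ) ^ 5 * exp 1 * κb ^ 2 * crb) → ψ = exp 4 * ccb ^ 2 / κb ^ 2 →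
        τ = exp 2 * κb ^ 2 / ccb ^ 2 → 0 ≤ ι₁ →
      ∀ (ρk Q' Q κA Yb Y A A' ι₃ : ℝ), ρk = max 4 (2 * τ * ψ) → Q' = Z * Qb + 1 → Q = ρk * Q' →
        κA = W * ((27 : ℝ) ^ 5 * (C₁ / C₂) * (8 : ℝ) ^ (d - 1)) →
        Yb = ι₂ / (2 * Q') + W * Z ^ 3 * X / (4 * Q' ^ 2) + (W * (27 : ℝ) ^ 5 * Ab + κA * Ab) * Q' / 2 →
        Y = ι₂' / (2 * Q') + W * Z ^ 3 * X' / (4 * Q' ^ 2) + (W * (27 : ℝ) ^ 5 * Ab' + κA * Ab') * Q' / 2 →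
        A = 2 * Y * (1 - ((2 : ℝ) ^ d)⁻¹) / (κA * Q') →
        A' = (W * (27 : ℝ) ^ 5 * Ab' + κA * Ab') + 2 * Y / Q' → ι₃ = W * Z ^ 3 * X' + A' * Q' ^ 3 →
      max 1 Z * C₂ ^ 2 * max 4 (2 * τ * ψ) ≤ (2 : ℝ) ^ (d - 1) →
      max 1 (max (8 * Φ * τ * Yb) (128 * exp 1 * ψ ^ 3 * τ ^ 4 * Φ * κA * Yb / ((1 - ((2 : ℝ) ^ d)⁻¹) * ρk ^ 3))) ≤ B →
      -- E1's imports and six-leg cells, block by block, each at the block's own base level `λ_{dk} = B·ε_{dk}` (monotone in the level)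
      (∀ k, 1 ≤ k → d * k ≤ n → W * Z ^ 1 * klTowerMuLevF L M β U μ (klFlowFrameU L M β U μ n) d k 1 ≤ ι₁ * (B * epsCoupling P U (d * k))) →
      (∀ k, 1 ≤ k → d * k ≤ n → W * Z ^ 2 * klTowerMuLevF L M β U μ (klFlowFrameU L M β U μ n) d k 2 ≤ ι₂' * (B * epsCoupling P U (d * k))) →
      (∀ k, 2 ≤ k → d * k ≤ n → klTowerMuLevAtF L M β U μ (klFlowFrameU L M β U μ n) d 0 k 3 ≤ X' * (B * epsCoupling P U (d * k)) ^ 2) →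
      U ≤ min 1 (min (1 / (8 * σ * Q' + 1)) (min (1 / (2 * exp 1 * τ * Q' + 1)) (min (1 / (4 * Φ * τ * ι₁ + 1))
        (min (1 / (2 * (Φ * (exp 1 * τ * ι₁ + (exp 1 * τ) ^ 2 * ι₂' + (exp 1 * τ) ^ 3 * ι₃ + A' * (exp 1 * τ * Q') ^ 2 / 2)) + 1))
          (min (A * Q ^ 3 / (16 * σ * Q' * A' * (4 * Q') ^ 3 + A * Q ^ 3))
            (A * Q ^ 3 / (16 * exp 1 * ψ * (2 * τ * ψ * Q') ^ 2 * Φ * τ ^ 2 * ι₁ ^ 2 + A * Q ^ 3))))))) / (2 * B * P.Klam + 1) →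
      cc ≤ min 1 (min (1 / (8 * σ * Q' + 1)) (min (1 / (2 * exp 1 * τ * Q' + 1)) (min (1 / (4 * Φ * τ * ι₁ + 1))
        (min (1 / (2 * (Φ * (exp 1 * τ * ι₁ + (exp 1 * τ) ^ 2 * ι₂' + (exp 1 * τ) ^ 3 * ι₃ + A' * (exp 1 * τ * Q') ^ 2 / 2)) + 1))
          (min (A * Q ^ 3 / (16 * σ * Q' * A' * (4 * Q') ^ 3 + A * Q ^ 3))
            (A * Q ^ 3 / (16 * exp 1 * ψ * (2 * τ * ψ * Q') ^ 2 * Φ * τ ^ 2 * ι₁ ^ 2 + A * Q ^ 3))))))) * Real.log 4 / (2 * B * P.Klam + 1) →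
      -- the read-out constants (equational binders; `Atot` level by level through `λ_j = B·ε_j`), the public constant's threshold at every level `d ≤ j ≤ n`,
      -- the degree cap, the six-leg cells at every level `d ≤ j ≤ n`
      ∀ (Aro Qro Qtot : ℝ) (Atot : ℕ → ℝ), Aro = (27 : ℝ) ^ 5 * (C₁' / C₂') * (Ab' + (8 : ℝ) ^ (d - 1) * (A / (1 - ((2 : ℝ) ^ d)⁻¹))) →
        Qro = C₂' ^ 2 * max Qb (((2 : ℝ) ^ (d - 1))⁻¹ * max Q Qb) → Qtot = Dinc * max 1 (max Qro (max (4 * Q') (2 * τ * ψ * Q'))) →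
        (∀ j : ℕ, Atot j = Aro + Cinc * (A' * (4 * σ * (B * epsCoupling P U j) * Q' / (1 - 4 * σ * (B * epsCoupling P U j) * Q')) +
          exp 1 * (τ * (ι₁ * (B * epsCoupling P U j) + ι₂' / (2 * Q') + ι₃ / (4 * Q' ^ 2) + A' * Q' / 4)) *
            (Φ * (τ * (ι₁ * (B * epsCoupling P U j) + ι₂' / (2 * Q') + ι₃ / (4 * Q' ^ 2) + A' * Q' / 4)) /
              (1 - Φ * (τ * (ι₁ * (B * epsCoupling P U j) + ι₂' / (2 * Q') + ι₃ / (4 * Q' ^ 2) + A' * Q' / 4)))) / (2 * τ * Q'))) →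
      ∀ Qe : EngConsts, (∀ j : ℕ, d ≤ j → j ≤ n → Qtot * imagTimeWeight β M ^ 2 * B * max 1 (Atot j / imagTimeWeight β M) ≤ Qe.CE) →
      Fintype.card (HubbardFieldIdx L M) ≤ 2 * D + 1 →
      (∀ j : ℕ, 1 ≤ j → j ≤ n → ∀ Ωe : Fin (2 * 3) → Option (SectorLeg (sectorCount j)), levelCount Ωe = 1 →
        klAnisoLegKernelNormAt L M β U μ (klFlowFrameU L M β U μ n) klE0 j (2 * 3) Ωe ≤ Qe.CE ^ 3 * (epsCoupling P U j) ^ 2 * (2 : ℝ) ^ ((4 : ℤ) * j)) →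
      -- THE LEVELS `1 ≤ j < d` (block 0, p3 g22's `kernelNormsLevels_blockZeroF_klEng`): the partition function at `Λ_1`, the level-0 datum of `𝒱_1[K_n]`
      -- at `F_0` with its unit law AT `λ_1 = B·ε_1` (moved to the level inside), the kit cap at `sectorCount 0`, block 0's own pins, the Chernoff data and
      -- imports of `W₀·Z₀^m·klTowerMuLevF … 1 1 m` AT `λ_1`, the five smallness rows and the CE threshold at every level `1 ≤ j < d`
      hubbardEffPartitionFnCT L M β U μ 0 (klFlowFrameU L M β U μ n) (klScale klE0 1) ≠ 0 →
      ∀ (Ab₀ Qb₀ : ℝ), 0 ≤ Ab₀ → 0 ≤ Qb₀ →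
      ∀ Nb₀ : Fin 5 → ℕ → ℝ, (∀ t p, 0 ≤ Nb₀ t p) →
        (∀ (t : Fin 5) (p : ℕ) (Ωe' : Fin (2 * p) → Option (SectorLeg (sectorCount 0))), levelCount Ωe' = (t : ℕ) + 1 →
          klLevNormOf L M β μ (klFlowFrameU L M β U μ n) 0 (2 * p) (klTowerInput L M β U μ (klFlowFrameU L M β U μ n) 1 1) Ωe' ≤ Nb₀ t p) →
        (∀ (t : Fin 5) (p : ℕ), 3 ≤ p → Nb₀ t p / klLevUnitF β M t p 0 ≤ Ab₀ * (B * epsCoupling P U 1) ^ (p - 1) * Qb₀ ^ p) →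
      Fintype.card (SpaceTimeIdx L M × SectorLeg (sectorCount 0)) / 2 ≤ D →
      ∀ (κb₀ αb₀ crb₀ ccb₀ : ℝ), κb₀ = Real.sqrt (2 * Cκ₀ * klE0) → αb₀ = Cb₀ * ((M : ℝ) / β) * (4 : ℝ) ^ d / klE0 →
        crb₀ = 81 * CJ₀ * M / β → ccb₀ = 162 * CJ₀ * M / β →
      ∀ (W₀ Z₀ σ₀ Φ₀ ψ₀ τ₀ : ℝ), W₀ = 64 * (27 : ℝ) ^ 4 * exp 2 * crb₀ / ccb₀ → Z₀ = exp 4 * ccb₀ ^ 2 * imagTimeWeight β M ^ 2 / 8 →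
        σ₀ = κb₀ ^ 2 / (exp 4 * ccb₀ ^ 2) → Φ₀ = 9 * αb₀ * ccb₀ / ((27 : ℝ) ^ 5 * exp 1 * κb₀ ^ 2 * crb₀) → ψ₀ = exp 4 * ccb₀ ^ 2 / κb₀ ^ 2 →
        τ₀ = exp 2 * κb₀ ^ 2 / ccb₀ ^ 2 →
      ∀ (A'₀ Q'₀ ι₁₀ ι₂₀ ι₃₀ : ℝ), 0 ≤ A'₀ → 0 < Q'₀ →
      (∀ m, 4 ≤ m → m ≤ D → W₀ * Z₀ ^ m * klTowerMuLevF L M β U μ (klFlowFrameU L M β U μ n) 1 1 m ≤ A'₀ * (B * epsCoupling P U 1) ^ (m - 1) * Q'₀ ^ m) →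
      W₀ * Z₀ ^ 3 * klTowerMuLevF L M β U μ (klFlowFrameU L M β U μ n) 1 1 3 ≤ ι₃₀ * (B * epsCoupling P U 1) ^ 2 →
      W₀ * Z₀ ^ 1 * klTowerMuLevF L M β U μ (klFlowFrameU L M β U μ n) 1 1 1 ≤ ι₁₀ * (B * epsCoupling P U 1) →
      W₀ * Z₀ ^ 2 * klTowerMuLevF L M β U μ (klFlowFrameU L M β U μ n) 1 1 2 ≤ ι₂₀ * (B * epsCoupling P U 1) →
      (∀ j : ℕ, 1 ≤ j → j ≤ d → j ≤ n →
        4 * σ₀ * (B * epsCoupling P U j) * Q'₀ < 1 ∧ 2 * (B * epsCoupling P U j) * τ₀ * Q'₀ ≤ 1 ∧ exp 1 * τ₀ * (B * epsCoupling P U j) * Q'₀ < 1 ∧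
        Φ₀ * (τ₀ * (ι₁₀ * (B * epsCoupling P U j) + ι₂₀ / (2 * Q'₀) + ι₃₀ / (4 * Q'₀ ^ 2) + A'₀ * Q'₀ / 4)) < 1 ∧
        Φ₀ * (exp 1 * τ₀ * (ι₁₀ * (B * epsCoupling P U j)) + (exp 1 * τ₀) ^ 2 * (ι₂₀ * (B * epsCoupling P U j)) +
            (exp 1 * τ₀) ^ 3 * (ι₃₀ * (B * epsCoupling P U j) ^ 2) +
          A'₀ * (exp 1 * τ₀ * Q'₀) * ((exp 1 * τ₀ * (B * epsCoupling P U j) * Q'₀) ^ 3 / (1 - exp 1 * τ₀ * (B * epsCoupling P U j) * Q'₀))) < 1) →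
      ∀ (Aro₀ Qro₀ Qtot₀ : ℝ) (Atot₀ : ℕ → ℝ), Aro₀ = Cinc₀ * Ab₀ → Qro₀ = Dinc₀ * Qb₀ → Qtot₀ = Dinc₀ * max 1 (max Qro₀ (max (4 * Q'₀) (2 * τ₀ * ψ₀ * Q'₀))) →
        (∀ j : ℕ, Atot₀ j = Aro₀ + Cinc₀ * (A'₀ * (4 * σ₀ * (B * epsCoupling P U j) * Q'₀ / (1 - 4 * σ₀ * (B * epsCoupling P U j) * Q'₀)) +
          exp 1 * (τ₀ * (ι₁₀ * (B * epsCoupling P U j) + ι₂₀ / (2 * Q'₀) + ι₃₀ / (4 * Q'₀ ^ 2) + A'₀ * Q'₀ / 4)) *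
            (Φ₀ * (τ₀ * (ι₁₀ * (B * epsCoupling P U j) + ι₂₀ / (2 * Q'₀) + ι₃₀ / (4 * Q'₀ ^ 2) + A'₀ * Q'₀ / 4)) /
              (1 - Φ₀ * (τ₀ * (ι₁₀ * (B * epsCoupling P U j) + ι₂₀ / (2 * Q'₀) + ι₃₀ / (4 * Q'₀ ^ 2) + A'₀ * Q'₀ / 4)))) / (2 * τ₀ * Q'₀))) →
      (∀ j : ℕ, 1 ≤ j → j < d → j ≤ n → Qtot₀ * imagTimeWeight β M ^ 2 * B * max 1 (Atot₀ j / imagTimeWeight β M) ≤ Qe.CE) →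
      -- block 0's BASE read-out constants at `λ_d` (`baseLawF_blockZero_sharp`'s, `Cinc₁ Dinc₁ ≥ 1`), their domination by the main tower's `Ab' Qb`
      -- (GUARDED by `d ≤ n`: only then is `λ_d` a level of the flow), and the block-`0` kit guard (born step of every level `j ≤ d` AND `Z` at `Λ_d`)
      ∀ (Aro₁ Qro₁ Qtot₁ Atot₁ : ℝ), Aro₁ = Cinc₁ * Ab₀ → Qro₁ = Dinc₁ * Qb₀ → Qtot₁ = Dinc₁ * max 1 (max Qro₁ (max (4 * Q'₀) (2 * τ₀ * ψ₀ * Q'₀))) →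
        Atot₁ = Aro₁ + Cinc₁ * (A'₀ * (4 * σ₀ * (B * epsCoupling P U d) * Q'₀ / (1 - 4 * σ₀ * (B * epsCoupling P U d) * Q'₀)) +
          exp 1 * (τ₀ * (ι₁₀ * (B * epsCoupling P U d) + ι₂₀ / (2 * Q'₀) + ι₃₀ / (4 * Q'₀ ^ 2) + A'₀ * Q'₀ / 4)) *
            (Φ₀ * (τ₀ * (ι₁₀ * (B * epsCoupling P U d) + ι₂₀ / (2 * Q'₀) + ι₃₀ / (4 * Q'₀ ^ 2) + A'₀ * Q'₀ / 4)) /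
              (1 - Φ₀ * (τ₀ * (ι₁₀ * (B * epsCoupling P U d) + ι₂₀ / (2 * Q'₀) + ι₃₀ / (4 * Q'₀ ^ 2) + A'₀ * Q'₀ / 4)))) / (2 * τ₀ * Q'₀)) →
      (d ≤ n → Atot₁ ≤ Ab') → (d ≤ n → Qtot₁ ≤ Qb) →
      Φ₀ * towerV D τ₀ (fun m => W₀ * Z₀ ^ m * klTowerMuLevF L M β U μ (klFlowFrameU L M β U μ n) 1 1 m) < 1 →
      -- THE LEVEL `j = 0`: p3's weighted grid step at `(Λ_0, F_0)` (RO-3's closer `kernelNormsLevels_uvF_of_wgridStep` at `j = 0`)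
      ∀ (jw0 : ℕ) (κ0 αw0 ρ0 crw0 ccw0 : ℝ), 0 < κ0 →
        IsGramBoundedR ((hubbardGridSub L M β (2 * (2 * M))).transpose * hubbardCovAboveCT L M β μ 0 (klFlowFrameU L M β U μ n) (klScale klE0 0) *
          hubbardGridSub L M β (2 * (2 * M))) κ0 →
        0 < αw0 →
        (∀ X, ∑ Y, ‖((hubbardGridSub L M β (2 * (2 * M))).transpose * hubbardCovAboveCT L M β μ 0 (klFlowFrameU L M β U μ n) (klScale klE0 0) *
          hubbardGridSub L M β (2 * (2 * M))) X Y‖ * gridLabelWt L (2 * (2 * M)) β {gridLegPos X, gridLegPos Y} ≤ αw0) →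
        (∀ Y, ∑ X, ‖((hubbardGridSub L M β (2 * (2 * M))).transpose * hubbardCovAboveCT L M β μ 0 (klFlowFrameU L M β U μ n) (klScale klE0 0) *
          hubbardGridSub L M β (2 * (2 * M))) X Y‖ * gridLabelWt L (2 * (2 * M)) β {gridLegPos X, gridLegPos Y} ≤ αw0) →
        0 < ρ0 →
        Real.exp 1 * αw0 * normV (GridLeg (GridPoint L (2 * (2 * M)))) κ0 ρ0
          (fun m' : ℕ => if m' = 1 then |β| / (2 * (2 * M) : ℕ) * ∑ z : TorusSite 2 L, ‖framePosKernel L (klFlowFrameU L M β U μ n) z‖ * (1 + torusSiteDist z 0)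
            else if m' = 2 then |U| * |β| / (2 * (2 * M) : ℕ) else 0) / κ0 ^ 2 < 1 →
        0 < crw0 → 0 < ccw0 →
        (∀ X'' : SpaceTimeIdx L M × SectorLeg (sectorCount 0), ∑ X' : GridLeg (GridPoint L (2 * (2 * M))),
          ‖(sectorAnalysisMatrix L M β (klAnisoFamily L M β μ (klFlowFrameU L M β U μ n) klE0 0) * hubbardGridSub L M β (2 * (2 * M))) X'' X'‖ *
            gridLabelWt L (2 * (2 * M)) β {latticeLegPos (2 * (2 * M)) X'', gridLegPos X'} ≤ crw0) →
        (∀ X' : GridLeg (GridPoint L (2 * (2 * M))), ∑ X'' : SpaceTimeIdx L M × SectorLeg (sectorCount 0),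
          ‖(sectorAnalysisMatrix L M β (klAnisoFamily L M β μ (klFlowFrameU L M β U μ n) klE0 0) * hubbardGridSub L M β (2 * (2 * M))) X'' X'‖ *
            gridLabelWt L (2 * (2 * M)) β {latticeLegPos (2 * (2 * M)) X'', gridLegPos X'} ≤ ccw0) →
      ∀ (nV0 cF0 cg0 Ag0 Pg0 Auv0 Quv0 : ℝ),
        nV0 = normV (GridLeg (GridPoint L (2 * (2 * M)))) κ0 ρ0
          (fun m' : ℕ => if m' = 1 then |β| / (2 * (2 * M) : ℕ) * ∑ z : TorusSite 2 L, ‖framePosKernel L (klFlowFrameU L M β U μ n) z‖ * (1 + torusSiteDist z 0)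
            else if m' = 2 then |U| * |β| / (2 * (2 * M) : ℕ) else 0) →
        cF0 = (Real.exp 2 * (κ0 + ρ0)) ^ (2 * 2) * (|β| / (2 * (2 * M) : ℕ)) → cg0 = Real.exp 1 * αw0 * cF0 / κ0 ^ 2 →
        Ag0 = crw0 * Real.exp 1 * cF0 / (ccw0 * cg0 ^ 2) → Pg0 = ccw0 ^ 2 * cg0 / (ρ0 ^ 2 * (1 - Real.exp 1 * αw0 * nV0 / κ0 ^ 2)) →
        Auv0 = (2 : ℝ) ^ (7 * 0) * Ag0 / P.Klam ^ 2 / B ^ 2 → Quv0 = Pg0 / (8 : ℝ) ^ 0 →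
        Quv0 * imagTimeWeight β M ^ 2 * B * max 1 (Auv0 / imagTimeWeight β M) ≤ Qe.CE →
      ∀ j : ℕ, j ≤ n → KernelNormsLevels L M P Qe β U μ (klFlowFrameU L M β U μ n) j := by
  obtain ⟨C₁, C₂, C₁', C₂', Cinc, Dinc, hC₁, hC₂, hC₁', hC₂', hCinc, hDinc, h⟩ := kernelNormsLevels_readoutF_klEng_sharp_unif_rows c'' hc''
  refine ⟨C₁, C₂, C₁', C₂', Cinc, Dinc, hC₁, hC₂, hC₁', hC₂', hCinc, hDinc, fun R hR2 => ?_⟩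
  obtain ⟨c₃, hc₃, U₀, hU₀, Cκ, CJ, hCκ, hCJ, hd⟩ := h R hR2
  refine ⟨c₃, hc₃, U₀, hU₀, Cκ, CJ, hCκ, hCJ, fun d => ?_⟩
  obtain ⟨Cb, hCb, h'⟩ := hd d
  obtain ⟨Cinc₀, Dinc₀, Cinc₁, Dinc₁, hCinc₀, hDinc₀, hCinc₁, hDinc₁, h5⟩ := blockZeroPackage_klEng d c'' hc''
  obtain ⟨c₃'', hc₃'', U₀'', hU₀'', Cκ₀, Cb₀, CJ₀, hCκ₀, hCb₀, hCJ₀, h5'⟩ := h5 R hR2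
  refine ⟨Cb, hCb, Cinc₀, Dinc₀, Cinc₁, Dinc₁, c₃'', U₀'', hCinc₀, hDinc₀, hCinc₁, hDinc₁, hc₃'', hU₀'', Cκ₀, Cb₀, CJ₀, hCκ₀, hCb₀, hCJ₀, ?_⟩
  intro G P Qh c hP hc hc6 hc₃' hc₃'' μ hμ U hU hU9 hU₀' hU₀'' hcU β hβmin hβc L M _ _ hL3 hM3 n hn1 hnN hreg hhist hfr hosc hd D hD cc n' hreg' hnn' B hB
    Ab Qb ι₂ X hAb hQb hι₂ hX Ab' ι₂' X' hAb' hι₂' hX'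
    κb αb crb ccb hκb hαb hcrb hccb hDall W Z σ Φ ψ τ ι₁ hW hZ hσ hΦ hψ hτ hι₁ ρk Q' Q κA Yb Y A A' ι₃ hρk hQ' hQ hκA hYb hY hA hA' hι₃ hblock hBle
    himp₁ himp₂ hcell hUdoor hcdoor Aro Qro Qtot Atot hAro hQro hQtot hAtot Qe hCE hcard hsix
    hZ1 Ab₀ Qb₀ hAb₀ hQb₀ Nb₀ hNb₀0 hcar₀ hlawb₀ hD0 κb₀ αb₀ crb₀ ccb₀ hκb₀ hαb₀ hcrb₀ hccb₀ W₀ Z₀ σ₀ Φ₀ ψ₀ τ₀ hW₀ hZ₀ hσ₀ hΦ₀ hψ₀ hτ₀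
    A'₀ Q'₀ ι₁₀ ι₂₀ ι₃₀ hA'₀ hQ'₀ hprof₀ hprof3₀ himp₁₀ himp₂₀ hsmall₀ Aro₀ Qro₀ Qtot₀ Atot₀ hAro₀ hQro₀ hQtot₀ hAtot₀ hCE₀
    Aro₁ Qro₁ Qtot₁ Atot₁ hAro₁ hQro₁ hQtot₁ hAtot₁ hAtle hQtle hguard₀
    jw0 κ0 αw0 ρ0 crw0 ccw0 hκ0 hGB0 hαw0 hrow0 hcol0 hρ0 hθ0 hcrw0 hccw0 hrow0' hcol0' nV0 cF0 cg0 Ag0 Pg0 Auv0 Quv0 hnV0 hcF0 hcg0 hAg0 hPg0 hAuv0 hQuv0 hCEu0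
    j hj
  have hβ : 0 < β := KLRegimeSplit.pos_of_klBetaMin_le hβmin
  by_cases hjd : j < d
  · rcases Nat.eq_zero_or_pos j with rfl | hj1
    · -- the level `j = 0`: RO-3's closer at `(Λ_0, F_0)`
      exact kernelNormsLevels_uvF_of_wgridStep hβ hP U hU μ (klFlowFrameU L M β U μ n) 0 hB jw0 hκ0 hGB0 hαw0 hrow0 hcol0 hρ0 hθ0 hcrw0 hccw0
        hrow0' hcol0' hnV0 hcF0 hcg0 hAg0 hPg0 hAuv0 hQuv0 hCEu0
    · -- the levels `1 ≤ j < d`: block 0's closer (p3 g22), its rows moved from `λ_1` to `λ_j`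
      have hK1 : 1 ≤ P.Klam := hP.1
      have hKl : 0 ≤ P.Klam := le_trans zero_le_one hK1
      have hB0 : 0 < B := lt_of_lt_of_le one_pos hB
      have hε1 : 0 < epsCoupling P U 1 := by
        unfold epsCoupling
        have : 0 < |U| + U ^ 2 * ((1 : ℕ) : ℝ) := by positivity
        positivity
      have hl1 : 0 < B * epsCoupling P U 1 := mul_pos hB0 hε1
      have hεmono1 : epsCoupling P U 1 ≤ epsCoupling P U j := by
        unfold epsCoupling
        exact mul_le_mul_of_nonneg_left ((add_le_add_iff_left |U|).2 (mul_le_mul_of_nonneg_left (Nat.cast_le.2 hj1) (sq_nonneg U))) hKl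
      have hlle : B * epsCoupling P U 1 ≤ B * epsCoupling P U j := mul_le_mul_of_nonneg_left hεmono1 hB0.le
      have hM0 : (0 : ℝ) < M := Nat.cast_pos.2 (Nat.pos_of_ne_zero (NeZero.ne M))
      have he0 : (0 : ℝ) < klE0 := by norm_num [klE0]
      have hκb₀0 : 0 < κb₀ := by rw [hκb₀]; exact Real.sqrt_pos.2 (by positivity)
      have hcrb₀0 : 0 < crb₀ := by rw [hcrb₀]; positivity
      have hccb₀0 : 0 < ccb₀ := by rw [hccb₀]; positivity
      have hW₀0 : 0 < W₀ := by rw [hW₀]; positivity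
      have hZ₀0 : 0 < Z₀ := by
        have hεx : 0 < imagTimeWeight β M := by unfold imagTimeWeight; positivity
        rw [hZ₀]; positivity
      have hμ0 : ∀ m, 0 ≤ W₀ * Z₀ ^ m * klTowerMuLevF L M β U μ (klFlowFrameU L M β U μ n) 1 1 m := fun m =>
        mul_nonneg (by positivity) (klTowerMuLevF_nonneg (L := L) (M := M) hβ U μ _ 1 1 m)
      -- the signs of the imports from their rows at `λ_1`
      have hι₁0 : 0 ≤ ι₁₀ := by
        have h1 : 0 ≤ ι₁₀ * (B * epsCoupling P U 1) := (hμ0 1).trans himp₁₀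
        rw [mul_comm] at h1
        exact nonneg_of_mul_nonneg_right h1 hl1
      have hι₂0 : 0 ≤ ι₂₀ := by
        have h1 : 0 ≤ ι₂₀ * (B * epsCoupling P U 1) := (hμ0 2).trans himp₂₀
        rw [mul_comm] at h1
        exact nonneg_of_mul_nonneg_right h1 hl1
      have hι₃0 : 0 ≤ ι₃₀ := by
        have h1 : 0 ≤ ι₃₀ * (B * epsCoupling P U 1) ^ 2 := (hμ0 3).trans hprof3₀
        rw [mul_comm] at h1
        exact nonneg_of_mul_nonneg_right h1 (by positivity)
      obtain ⟨hx₁, hx₂, hx₃, hy, hθ'⟩ := hsmall₀ j hj1 hjd.le hj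
      exact (h5' G P Qh c hP hc hc6 hc₃'' μ hμ U hU hU9 hU₀'' hcU β hβmin hβc L M hL3 hM3 n hn1 hnN hreg hhist hfr hosc j D hj1 hjd.le hj hD hZ1
        B Ab₀ Qb₀ hB hAb₀ hQb₀ Nb₀ hNb₀0 hcar₀
        (fun t p hp => (hlawb₀ t p hp).trans
          (mul_le_mul_of_nonneg_right (mul_le_mul_of_nonneg_left (pow_le_pow_left₀ hl1.le hlle _) hAb₀) (pow_nonneg hQb₀ _)))
        hD0 κb₀ αb₀ crb₀ ccb₀ hκb₀ hαb₀ hcrb₀ hccb₀ W₀ Z₀ σ₀ Φ₀ ψ₀ τ₀ hW₀ hZ₀ hσ₀ hΦ₀ hψ₀ hτ₀ A'₀ Q'₀ ι₁₀ ι₂₀ ι₃₀ hA'₀ hQ'₀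
        (fun m hm hmD => (hprof₀ m hm hmD).trans
          (mul_le_mul_of_nonneg_right (mul_le_mul_of_nonneg_left (pow_le_pow_left₀ hl1.le hlle _) hA'₀) (pow_nonneg hQ'₀.le _)))
        (hprof3₀.trans (mul_le_mul_of_nonneg_left (pow_le_pow_left₀ hl1.le hlle 2) hι₃0))
        (himp₁₀.trans (mul_le_mul_of_nonneg_left hlle hι₁0))
        (himp₂₀.trans (mul_le_mul_of_nonneg_left hlle hι₂0))
        hx₁ hx₂ hx₃ hy hθ' hguard₀).2.2 Aro₀ Qro₀ Qtot₀ (Atot₀ j) hAro₀ hQro₀ hQtot₀ (hAtot₀ j) Qe (hCE₀ j hj1 hjd hj) hcard (hsix j hj1 hj)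
  · -- block `Kb = j / d ≥ 1`: closer‴ on the flow frame, the block rows moved from `λ_{dk}` to `λ_j`
    have hd0 : 0 < d := by omega
    have hdj : d ≤ j := not_lt.1 hjd
    set Kb : ℕ := j / d with hKbdef
    have hKb1 : 1 ≤ Kb := Nat.div_pos hdj hd0
    have hKbj : d * Kb ≤ j := Nat.mul_div_le j d
    have hjK : j ≤ d * (Kb + 1) := (Nat.lt_mul_div_succ j hd0).le
    have hKbn : d * Kb ≤ n := hKbj.trans hj
    have hjN : j ≤ nScales β + 1 := hj.trans hnN
    have hjn' : j ≤ n' := hj.trans hnn'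
    have hKl : 0 ≤ P.Klam := le_trans zero_le_one hP.1
    have hB0 : 0 ≤ B := zero_le_one.trans hB
    have hε0 : ∀ i, 0 ≤ epsCoupling P U i := fun i => by unfold epsCoupling; positivity
    have hεmono : ∀ i, i ≤ j → epsCoupling P U i ≤ epsCoupling P U j := fun i hi => by
      unfold epsCoupling
      exact mul_le_mul_of_nonneg_left ((add_le_add_iff_left |U|).2 (mul_le_mul_of_nonneg_left (Nat.cast_le.2 hi) (sq_nonneg U))) hKl
    have hι₂'0 : 0 ≤ ι₂' := by rw [hι₂']; exact div_nonneg hι₂ hB0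
    have hX'0 : 0 ≤ X' := by rw [hX']; positivity
    have hAb'0 : 0 ≤ Ab' := by rw [hAb']; positivity
    -- the base datum of the tower and `Z^{K_n}_{Λ_d}` from block 0 (ONE package, shared pins), its level-0 rows lifted from `λ_1` to `λ_d`
    have hd1 : 1 ≤ d := by omega
    have hdn : d ≤ n := hdj.trans hj
    have hB0' : 0 < B := lt_of_lt_of_le one_pos hB
    have hK1 : 1 ≤ P.Klam := hP.1
    have hε1 : 0 < epsCoupling P U 1 := by
      unfold epsCoupling
      have : 0 < |U| + U ^ 2 * ((1 : ℕ) : ℝ) := by positivity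
      positivity
    have hl1 : 0 < B * epsCoupling P U 1 := mul_pos hB0' hε1
    have hεmono1d : epsCoupling P U 1 ≤ epsCoupling P U d := by
      unfold epsCoupling
      exact mul_le_mul_of_nonneg_left ((add_le_add_iff_left |U|).2 (mul_le_mul_of_nonneg_left (Nat.cast_le.2 hd1) (sq_nonneg U))) hKl
    have hlled : B * epsCoupling P U 1 ≤ B * epsCoupling P U d := mul_le_mul_of_nonneg_left hεmono1d hB0
    have hM0 : (0 : ℝ) < M := Nat.cast_pos.2 (Nat.pos_of_ne_zero (NeZero.ne M))
    have he0 : (0 : ℝ) < klE0 := by norm_num [klE0]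
    have hcrb₀0 : 0 < crb₀ := by rw [hcrb₀]; positivity
    have hccb₀0 : 0 < ccb₀ := by rw [hccb₀]; positivity
    have hW₀0 : 0 < W₀ := by rw [hW₀]; positivity
    have hZ₀0 : 0 < Z₀ := by
      have hεx : 0 < imagTimeWeight β M := by unfold imagTimeWeight; positivity
      rw [hZ₀]; positivity
    have hμ00 : ∀ m, 0 ≤ W₀ * Z₀ ^ m * klTowerMuLevF L M β U μ (klFlowFrameU L M β U μ n) 1 1 m := fun m =>
      mul_nonneg (by positivity) (klTowerMuLevF_nonneg (L := L) (M := M) hβ U μ _ 1 1 m)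
    have hι₁00 : 0 ≤ ι₁₀ := by
      have h1 : 0 ≤ ι₁₀ * (B * epsCoupling P U 1) := (hμ00 1).trans himp₁₀
      rw [mul_comm] at h1
      exact nonneg_of_mul_nonneg_right h1 hl1
    have hι₂00 : 0 ≤ ι₂₀ := by
      have h1 : 0 ≤ ι₂₀ * (B * epsCoupling P U 1) := (hμ00 2).trans himp₂₀
      rw [mul_comm] at h1
      exact nonneg_of_mul_nonneg_right h1 hl1
    have hι₃00 : 0 ≤ ι₃₀ := by
      have h1 : 0 ≤ ι₃₀ * (B * epsCoupling P U 1) ^ 2 := (hμ00 3).trans hprof3₀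
      rw [mul_comm] at h1
      exact nonneg_of_mul_nonneg_right h1 (by positivity)
    obtain ⟨hx₁d, hx₂d, hx₃d, hyd, hθd⟩ := hsmall₀ d hd1 le_rfl hdn
    obtain ⟨hZd, hbase, -⟩ := h5' G P Qh c hP hc hc6 hc₃'' μ hμ U hU hU9 hU₀'' hcU β hβmin hβc L M hL3 hM3 n hn1 hnN hreg hhist hfr hosc d D hd1 le_rfl hdn hD hZ1
      B Ab₀ Qb₀ hB hAb₀ hQb₀ Nb₀ hNb₀0 hcar₀
      (fun t p hp => (hlawb₀ t p hp).trans
        (mul_le_mul_of_nonneg_right (mul_le_mul_of_nonneg_left (pow_le_pow_left₀ hl1.le hlled _) hAb₀) (pow_nonneg hQb₀ _)))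
      hD0 κb₀ αb₀ crb₀ ccb₀ hκb₀ hαb₀ hcrb₀ hccb₀ W₀ Z₀ σ₀ Φ₀ ψ₀ τ₀ hW₀ hZ₀ hσ₀ hΦ₀ hψ₀ hτ₀ A'₀ Q'₀ ι₁₀ ι₂₀ ι₃₀ hA'₀ hQ'₀
      (fun m hm hmD => (hprof₀ m hm hmD).trans
        (mul_le_mul_of_nonneg_right (mul_le_mul_of_nonneg_left (pow_le_pow_left₀ hl1.le hlled _) hA'₀) (pow_nonneg hQ'₀.le _)))
      (hprof3₀.trans (mul_le_mul_of_nonneg_left (pow_le_pow_left₀ hl1.le hlled 2) hι₃00))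
      (himp₁₀.trans (mul_le_mul_of_nonneg_left hlled hι₁00))
      (himp₂₀.trans (mul_le_mul_of_nonneg_left hlled hι₂00))
      hx₁d hx₂d hx₃d hyd hθd hguard₀
    have hlawb₁ := hbase hd hcard Aro₁ Qro₁ Qtot₁ Atot₁ hAro₁ hQro₁ hQtot₁ hAtot₁
    have hQtot₁0 : 0 ≤ Qtot₁ := by rw [hQtot₁]; exact mul_nonneg (zero_le_one.trans hDinc₁) (zero_le_one.trans (le_max_left _ _))
    obtain ⟨hNb0d, hcard'⟩ := klTowerMeasLev_one_baseRows (L := L) (M := M) hβ.le U μ (klFlowFrameU L M β U μ n) d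
    have hlawbd : ∀ (t : Fin 5) (p : ℕ), 3 ≤ p →
        klTowerMeasLev L M β U μ (klFlowFrameU L M β U μ n) d 1 (2 * p) ((t : ℕ) + 1) / klLevUnitF β M t p (d - 1) ≤ Ab' * (B * epsCoupling P U d) ^ (p - 1) * Qb ^ p :=
      fun t p hp => (hlawb₁ t p hp).trans
        (mul_le_mul (mul_le_mul_of_nonneg_right (hAtle hdn) (pow_nonneg (mul_nonneg hB0 (hε0 d)) _)) (pow_le_pow_left₀ hQtot₁0 (hQtle hdn) p)
          (pow_nonneg hQtot₁0 _) (mul_nonneg hAb'0 (pow_nonneg (mul_nonneg hB0 (hε0 d)) _)))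
    have hkj : ∀ k, k ≤ Kb → d * k ≤ j := fun k hk => le_trans (Nat.mul_le_mul_left d hk) hKbj
    exact h' G P Qh c hP hc hc6 hc₃' μ hμ U hU hU9 hU₀' hcU β hβmin hβc L M hL3 hM3 n hn1 hnN hreg hhist hfr hosc hd Kb D hKbn hD cc n' j hreg' hjn'
      hKb1 hKbj hjK hjN B Ab Qb ι₂ X hB hAb hQb hι₂ hX Ab' ι₂' X' hAb' hι₂' hX'
      (fun (t : Fin 5) (p : ℕ) => klTowerMeasLev L M β U μ (klFlowFrameU L M β U μ n) d 1 (2 * p) ((t : ℕ) + 1)) hNb0d hcard'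
      (fun t p hp => (hlawbd t p hp).trans (mul_le_mul_of_nonneg_right
        (mul_le_mul_of_nonneg_left (pow_le_pow_left₀ (mul_nonneg hB0 (hε0 d)) (mul_le_mul_of_nonneg_left (hεmono d hdj) hB0) _) hAb'0) (pow_nonneg hQb _)))
      hZd κb αb crb ccb hκb hαb hcrb hccb (fun k hk1 hk => hDall k hk1 ((hkj k hk.le).trans hj))
      W Z σ Φ ψ τ ι₁ hW hZ hσ hΦ hψ hτ hι₁ ρk Q' Q κA Yb Y A A' ι₃ hρk hQ' hQ hκA hYb hY hA hA' hι₃ hblock hBle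
      (fun k hk1 hk => (himp₁ k hk1 ((hkj k hk).trans hj)).trans
        (mul_le_mul_of_nonneg_left (mul_le_mul_of_nonneg_left (hεmono (d * k) (hkj k hk)) hB0) hι₁))
      (fun k hk1 hk => (himp₂ k hk1 ((hkj k hk).trans hj)).trans
        (mul_le_mul_of_nonneg_left (mul_le_mul_of_nonneg_left (hεmono (d * k) (hkj k hk)) hB0) hι₂'0))
      (fun k hk2 hk => (hcell k hk2 ((hkj k hk).trans hj)).trans
        (mul_le_mul_of_nonneg_left (pow_le_pow_left₀ (mul_nonneg hB0 (hε0 _)) (mul_le_mul_of_nonneg_left (hεmono (d * k) (hkj k hk)) hB0) 2) hX'0))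
      hUdoor hcdoor (hDall Kb hKb1 hKbn) Aro Qro Qtot (Atot j) hAro hQro hQtot (hAtot j) Qe (hCE j hdj hj) hcard (hsix j (le_trans (by omega : 1 ≤ d) hdj) hj)

end Summit.HubbardSuperconductivity.HubbardSuperconductivity.Theorems.EngineV8

end
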